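import Mathlib
import Literature.MathematicalPhysics.QuantumFieldTheory.Luscher2010.TrivializingMaps
import Literature.MathematicalPhysics.QuantumFieldTheory.Luscher2010.FlowActionSeries
import Summits.Ventures.LatticeQCDFlow.TrivializingMaps.LuscherSeriesExistence
import Summits.Ventures.LatticeQCDFlow.TrivializingMaps.LoopActionPolynomials
import HarnessLib

/-!
# A Haar-normalised, local Lüscher series for every Wilson-loop action (`d ≥ 2`)

HONEST FRAMING: exact (Metropolis-corrected) sampling algorithms for lattice gauge theory; figures of merit are
autocorrelation/cost numbers at stated couplings and volumes; no continuum-physics claim.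

Lüscher, CMP 293 (2010) 899, §4.5(b): "The series (4.11) is an expansion in local terms whose footprint on the
lattice increases proportionally to the order k" — for an action that is "a sum of Wilson loops" (§4 preamble).
The tree cites this as the named fact `LuscherSeriesLocal d n` (`Literature/…/Luscher2010/FlowActionSeries.lean`):
for every finite family of loop shapes with complex coefficients there is a constant `C` (independent of the
lattice size) such that on every periodic lattice the recursion (4.12)–(4.15) has a smooth, Haar-normalised
solution whose order-`k` term is a local sum of range `≤ C (k+1)`.

This file PROVES that statement in dimension `d ≥ 2` (`luscherSeriesLocal_of_two_le`), with `C = 4ℓ`, `ℓ` the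
maximal loop length, by running the anchored recursion of `LuscherSeriesExistence` (Wilson case) on a general
loop action `S = ∑_x s_x` (`LoopActionPolynomials`): `G^{(0)}_x` solves `Δ G = s_x - ⟨s_x⟩` inside the
finite-dimensional `Δ`-stable space `PD ℓ (linkBall 2ℓ (x,ν₀))` (`PoissonSolver`), and `G^{(k+1)}_x` solves
`Δ G = -∑_{e,a} ∂^a_e S · ∂^a_e G^{(k)}_x + const` inside `PD (ℓ(k+2)) (linkBall (2ℓ(2k+3)) (x,ν₀))` — the
right-hand side lives there because `∂_{e'} G^{(k)}_x = 0` unless `e'` is in the ball of `G^{(k)}_x` and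
`∂_{e'} S ∈ PD ℓ (linkBall 4ℓ e')` (`linkDeriv_loopAction_mem`). App. E's normalisation is met by subtracting
the Haar mean of every `G^{(k)}_x` (constants are invisible to `∂` and `Δ`). The orders are then
`S̃^{(k)} = ∑_x (G^{(k)}_x - ⟨G^{(k)}_x⟩)`: smooth, mean zero, local sums of range `2ℓ(2k+1) ≤ 4ℓ(k+1)`, and
they solve (4.12)–(4.15) with `Ċ^{(0)} = -∑_x ⟨s_x⟩`, `Ċ^{(k+1)} = ∑_x ⟨∑ ∂S ∂G^{(k)}_x⟩`.

Dimensions `d ≤ 1` (no plaquettes; closed loops have trivial holonomy) and the assembled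
`luscherSeriesLocal_holds : LuscherSeriesLocal d n` are in `LoopActionSeriesLowDim`.

References: M. Lüscher, CMP 293 (2010) 899 [Luscher2010Trivializing, arXiv:0907.5491], §4.3 eqs. (4.11)–(4.15),
§4.4, §4.5(a)–(b), App. E.2 (normalisation `P G φ = 0`).
-/

namespace Summit.Ventures.LatticeQCDFlow.TrivializingMaps

open MeasureTheory
open Literature.MathematicalPhysics.QuantumFieldTheory
open Literature.MathematicalPhysics.QuantumFieldTheory.Luscher2010
open scoped Matrix Matrix.Norms.Frobenius ContDiff

noncomputable section

section General

variable {d L n : ℕ} [NeZero L]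

/-! ## §1. Haar means and Lüscher's bilinear right-hand side for a general action -/

/-- The Haar mean `⟨f⟩ = ∫ D[U] f(U)` of an ambient functional over the field manifold `SU(n)^E`.
[cite: Luscher2010Trivializing, §2.1 eq. (2.3)] -/
def haarMean (f : AmbConfig d L n → ℝ) : ℝ :=
  ∫ U, f (WilsonFlow.coeConfig U) ∂(trivialMeasure (Matrix.specialUnitaryGroup (Fin n) ℂ) d L)

/-- Lüscher's bilinear right-hand side `∑_{e',a} ∂^a_{e'} S · ∂^a_{e'} f` of (4.13)/(4.15) (minus sign apart),
for a general action `S`. [cite: Luscher2010Trivializing, §4.3 eq. (4.15)] -/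
def actionRhs (B : SuBasis n) (S f : AmbConfig d L n → ℝ) : AmbConfig d L n → ℝ := fun W =>
  ∑ e' : Edge d L, ∑ a : B.ι, linkDeriv e' (B.T a) S W * linkDeriv e' (B.T a) f W

/-- **Footprint and degree growth of the recursion step**, general form: if every `∂_{e',X} S` is a link
polynomial of degree `≤ ℓ` supported in `linkBall R₁ e'`, and `f ∈ PD m (linkBall R e)`, then
`∑_{e',a} ∂S ∂f ∈ PD (m + ℓ) (linkBall (R + R₁) e)`. [cite: Luscher2010Trivializing, §4.5(a)] -/
theorem actionRhs_mem (B : SuBasis n) {S : AmbConfig d L n → ℝ} {ℓ R₁ : ℕ}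
    (hS : ∀ (e' : Edge d L) (X : Matrix (Fin n) (Fin n) ℂ), linkDeriv e' X S ∈ PD (n := n) ℓ (linkBall R₁ e'))
    {m R : ℕ} {e : Edge d L} {f : AmbConfig d L n → ℝ} (hf : f ∈ PD (n := n) m (linkBall R e)) :
    actionRhs B S f ∈ PD (n := n) (m + ℓ) (linkBall (R + R₁) e) := by
  have hfun : actionRhs B S f =
      ∑ e' : Edge d L, ∑ a : B.ι, linkDeriv e' (B.T a) S * linkDeriv e' (B.T a) f := by
    funext W; simp only [actionRhs, Finset.sum_apply, Pi.mul_apply]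
  rw [hfun]
  refine Submodule.sum_mem _ fun e' _ => Submodule.sum_mem _ fun a _ => ?_
  by_cases he' : e' ∈ linkBall R e
  · have hsub : linkBall R₁ e' ⊆ linkBall (R + R₁) e := fun e'' h'' => linkBall_add he' h''
    exact mul_mem_PD (by omega) (PD_mono le_rfl hsub (hS e' (B.T a)))
      (PD_mono le_rfl (linkBall_mono (by omega) e) (linkDeriv_mem_PD e' (B.T a) hf))
  · have h0 : linkDeriv e' (B.T a) f = 0 := linkDeriv_eq_zero_of_not_mem (B.T a) hf.2 he'
    rw [h0, mul_zero]
    exact Submodule.zero_mem _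

/-! ## §2. The anchored recursion for a loop action -/

/-- The maximal loop length `ℓ = max_{C ∈ 𝒞} |C|` of a family of loop shapes. [folklore] -/
def loopLen (shapes : Finset (PathWord d)) : ℕ := shapes.sup List.length

omit [NeZero L] in
/-- Every shape is at most `ℓ` long. [folklore] -/
theorem length_le_loopLen {shapes : Finset (PathWord d)} {w : PathWord d} (hw : w ∈ shapes) :
    w.length ≤ loopLen shapes :=
  Finset.le_sup (f := List.length) hw

/-- The **site term** `s_x(W) = ∑_{C ∈ 𝒞} Re(c_C tr U(C_x))` of the loop action, so that `S = ∑_x s_x`.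
[cite: Luscher2010Trivializing, §4.4 eq. (4.19)] -/
def loopSite (shapes : Finset (PathWord d)) (coef : PathWord d → ℂ) (x : Site d L) : AmbConfig d L n → ℝ :=
  fun W => ∑ w ∈ shapes, (coef w * (pathProd W x w).trace).re

omit [NeZero L] in
/-- `s_x ∈ PD (ℓ·(0+1)) (linkBall (2ℓ·(2·0+1)) (x, ν₀))` (index bookkeeping for the recursion). [folklore] -/
theorem loopSite_mem' (hd : 2 ≤ d) (shapes : Finset (PathWord d)) (coef : PathWord d → ℂ) (ν₀ : Fin d)
    (x : Site d L) :
    loopSite (n := n) shapes coef x ∈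
      PD (n := n) (loopLen shapes * (0 + 1)) (linkBall (2 * loopLen shapes * (2 * 0 + 1)) (x, ν₀)) :=
  PD_mono (by omega) (linkBall_mono (by omega) _)
    (loopSite_mem hd shapes coef (fun _ hw => length_le_loopLen hw) x ν₀)

/-- The recursion step keeps the bookkeeping: from `PD (ℓ(k+1)) (linkBall (2ℓ(2k+1)) (x,ν₀))` to
`PD (ℓ(k+2)) (linkBall (2ℓ(2k+3)) (x,ν₀))`. [cite: Luscher2010Trivializing, §4.5(a)] -/
theorem actionRhs_loop_mem (hd : 2 ≤ d) (B : SuBasis n) (shapes : Finset (PathWord d))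
    (coef : PathWord d → ℂ) (ν₀ : Fin d) {k : ℕ} {x : Site d L} {f : AmbConfig d L n → ℝ}
    (hf : f ∈ PD (n := n) (loopLen shapes * (k + 1)) (linkBall (2 * loopLen shapes * (2 * k + 1)) (x, ν₀))) :
    actionRhs B (loopAction shapes coef) f ∈
      PD (n := n) (loopLen shapes * (k + 1 + 1)) (linkBall (2 * loopLen shapes * (2 * (k + 1) + 1)) (x, ν₀)) := by
  have h := actionRhs_mem B
    (fun e' X => linkDeriv_loopAction_mem hd shapes coef (fun _ hw => length_le_loopLen hw) e' X) hf
  exact PD_mono (le_of_eq (by ring)) (linkBall_mono (le_of_eq (by ring)) _) h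

/-- **The anchored Lüscher recursion for a loop action** `G^{(k)}_x`: `G^{(0)}_x` solves `Δ G = s_x - ⟨s_x⟩` in
`PD ℓ (linkBall 2ℓ (x,ν₀))`, and `G^{(k+1)}_x` solves `Δ G = -(∑ ∂S ∂G^{(k)}_x) + ⟨∑ ∂S ∂G^{(k)}_x⟩` in
`PD (ℓ(k+2)) (linkBall (2ℓ(2k+3)) (x,ν₀))`. [cite: Luscher2010Trivializing, §4.3 eqs. (4.12)–(4.15), §4.4] -/
def loopRec (hd : 2 ≤ d) (B : SuBasis n) (shapes : Finset (PathWord d)) (coef : PathWord d → ℂ)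
    (ν₀ : Fin d) : (k : ℕ) → (x : Site d L) →
    {f : AmbConfig d L n → ℝ //
      f ∈ PD (n := n) (loopLen shapes * (k + 1)) (linkBall (2 * loopLen shapes * (2 * k + 1)) (x, ν₀))}
  | 0, x => ⟨solvePD B (loopSite_mem' hd shapes coef ν₀ x), solvePD_mem B (loopSite_mem' hd shapes coef ν₀ x)⟩
  | k + 1, x =>
      ⟨solvePD B (neg_mem (actionRhs_loop_mem hd B shapes coef ν₀ (loopRec hd B shapes coef ν₀ k x).2)),
        solvePD_mem B (neg_mem (actionRhs_loop_mem hd B shapes coef ν₀ (loopRec hd B shapes coef ν₀ k x).2))⟩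

end General

section Terms

variable {d n : ℕ} (hd : 2 ≤ d) (B : SuBasis n) (shapes : Finset (PathWord d)) (coef : PathWord d → ℂ)
  (ν₀ : Fin d)

section PerSite

variable {L : ℕ} [NeZero L]

/-- The order-`k`, site-`x` term `G^{(k)}_x` as a field functional. [folklore] -/
def loopTerm (k : ℕ) (x : Site d L) : AmbConfig d L n → ℝ := (loopRec hd B shapes coef ν₀ k x).1

/-- `G^{(k)}_x ∈ PD (ℓ(k+1)) (linkBall (2ℓ(2k+1)) (x,ν₀))`. [folklore] -/
theorem loopTerm_mem (k : ℕ) (x : Site d L) :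
    loopTerm hd B shapes coef ν₀ k x ∈
      PD (n := n) (loopLen shapes * (k + 1)) (linkBall (2 * loopLen shapes * (2 * k + 1)) (x, ν₀)) :=
  (loopRec hd B shapes coef ν₀ k x).2

/-- Unfolding the base case. [folklore] -/
theorem loopTerm_zero (x : Site d L) :
    loopTerm hd B shapes coef ν₀ 0 x = solvePD B (loopSite_mem' (n := n) hd shapes coef ν₀ x) := rfl

/-- Unfolding the successor case. [folklore] -/
theorem loopTerm_succ (k : ℕ) (x : Site d L) :
    loopTerm hd B shapes coef ν₀ (k + 1) x =
      solvePD B (neg_mem (actionRhs_loop_mem hd B shapes coef ν₀ (loopTerm_mem hd B shapes coef ν₀ k x))) :=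
  rfl

/-- Every term is smooth. [folklore] -/
theorem contDiff_loopTerm (k : ℕ) (x : Site d L) : ContDiff ℝ ∞ (loopTerm hd B shapes coef ν₀ k x) :=
  contDiff_of_mem_PD (loopTerm_mem hd B shapes coef ν₀ k x)

/-- The **normalised term** `G^{(k)}_x - ⟨G^{(k)}_x⟩` (App. E.2's normalisation `P G φ = 0`).
[cite: Luscher2010Trivializing, App. E.2] -/
def loopTermN (k : ℕ) (x : Site d L) : AmbConfig d L n → ℝ := fun W =>
  loopTerm hd B shapes coef ν₀ k x W - haarMean (loopTerm hd B shapes coef ν₀ k x)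

/-- The normalised term lies in the same space `PD (ℓ(k+1)) (linkBall (2ℓ(2k+1)) (x,ν₀))`. [folklore] -/
theorem loopTermN_mem (k : ℕ) (x : Site d L) :
    loopTermN hd B shapes coef ν₀ k x ∈
      PD (n := n) (loopLen shapes * (k + 1)) (linkBall (2 * loopLen shapes * (2 * k + 1)) (x, ν₀)) :=
  Submodule.sub_mem _ (loopTerm_mem hd B shapes coef ν₀ k x) (const_mem_PD _ _ _)

/-- The normalised term is smooth. [folklore] -/
theorem contDiff_loopTermN (k : ℕ) (x : Site d L) : ContDiff ℝ ∞ (loopTermN hd B shapes coef ν₀ k x) :=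
  contDiff_of_mem_PD (loopTermN_mem hd B shapes coef ν₀ k x)

/-- `∂` does not see the subtracted mean. [folklore] -/
theorem linkDeriv_loopTermN (k : ℕ) (x : Site d L) (e : Edge d L) (X : Matrix (Fin n) (Fin n) ℂ) :
    linkDeriv e X (loopTermN hd B shapes coef ν₀ k x) = linkDeriv e X (loopTerm hd B shapes coef ν₀ k x) := by
  funext W
  unfold loopTermN linkDeriv
  simp only [deriv_sub_const]

/-- `Δ` does not see the subtracted mean. [folklore] -/
theorem linkLap_loopTermN (k : ℕ) (x : Site d L) (W : AmbConfig d L n) :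
    linkLap B (loopTermN hd B shapes coef ν₀ k x) W = linkLap B (loopTerm hd B shapes coef ν₀ k x) W := by
  unfold linkLap
  simp only [linkDeriv_loopTermN]

end PerSite

variable (L : ℕ) [NeZero L]

/-- **The order-`k` flow action** `S̃^{(k)} = ∑_x (G^{(k)}_x - ⟨G^{(k)}_x⟩)`. [cite: Luscher2010Trivializing, §4.3] -/
def loopSk (k : ℕ) : AmbConfig d L n → ℝ := fun W => ∑ x : Site d L, loopTermN hd B shapes coef ν₀ k x W

/-- **The constants `Ċ^{(k)}`**: `Ċ^{(0)} = -∑_x ⟨s_x⟩ = -⟨S⟩`, `Ċ^{(k+1)} = ∑_x ⟨∑_{e',a} ∂S ∂G^{(k)}_x⟩`.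
[cite: Luscher2010Trivializing, §4.3 eqs. (4.14)–(4.15)] -/
def loopConst : ℕ → ℝ
  | 0 => -∑ x : Site d L, haarMean (loopSite (n := n) shapes coef x)
  | k + 1 => ∑ x : Site d L, haarMean (actionRhs B (loopAction shapes coef) (loopTerm hd B shapes coef ν₀ k x))

/-- Every order of the constructed flow action is smooth. [folklore] -/
theorem contDiff_loopSk (k : ℕ) : ContDiff ℝ ∞ (loopSk hd B shapes coef ν₀ L k) :=
  ContDiff.sum fun x _ => contDiff_loopTermN hd B shapes coef ν₀ k x

/-- **App. E's normalisation holds**: every order has zero Haar mean. [cite: Luscher2010Trivializing, App. E.2] -/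
theorem isHaarNormalised_loopSk : IsHaarNormalised (loopSk hd B shapes coef ν₀ L) := by
  intro k
  have hcont : ∀ x : Site d L, Continuous fun U : GaugeConfig d L (Matrix.specialUnitaryGroup (Fin n) ℂ) =>
      loopTerm hd B shapes coef ν₀ k x (WilsonFlow.coeConfig U) := fun x =>
    (contDiff_loopTerm hd B shapes coef ν₀ k x).continuous.comp WilsonFlow.continuous_coeConfig
  have hint : ∀ x : Site d L, Integrable (fun U : GaugeConfig d L (Matrix.specialUnitaryGroup (Fin n) ℂ) =>
      loopTermN hd B shapes coef ν₀ k x (WilsonFlow.coeConfig U))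
      (trivialMeasure (Matrix.specialUnitaryGroup (Fin n) ℂ) d L) := fun x =>
    (integrable_trivialMeasure_of_continuous (hcont x)).sub (integrable_const _)
  show ∫ U, ∑ x : Site d L, loopTermN hd B shapes coef ν₀ k x (WilsonFlow.coeConfig U)
    ∂(trivialMeasure (Matrix.specialUnitaryGroup (Fin n) ℂ) d L) = 0
  rw [integral_finsetSum _ fun x _ => hint x]
  refine Finset.sum_eq_zero fun x _ => ?_
  show ∫ U, (loopTerm hd B shapes coef ν₀ k x (WilsonFlow.coeConfig U) -
      haarMean (loopTerm hd B shapes coef ν₀ k x))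
    ∂(trivialMeasure (Matrix.specialUnitaryGroup (Fin n) ℂ) d L) = 0
  rw [integral_sub (integrable_trivialMeasure_of_continuous (hcont x)) (integrable_const _), integral_const]
  simp [haarMean]

/-- **Linear footprint growth**: `S̃^{(k)}` is a local sum of range `4ℓ(k+1)` (anchored at the links
`(x, ν₀)`; its actual range is `2ℓ(2k+1)`). [cite: Luscher2010Trivializing, §4.5(b)] -/
theorem isLocalSum_loopSk (k : ℕ) : IsLocalSum (4 * loopLen shapes * (k + 1)) (loopSk hd B shapes coef ν₀ L k) := by
  classical
  refine ⟨fun e W => if e.2 = ν₀ then loopTermN hd B shapes coef ν₀ k e.1 W else 0, fun e => ?_, ?_⟩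
  · intro W W' hWW'
    by_cases he : e.2 = ν₀
    · have he' : e = (e.1, ν₀) := Prod.ext rfl he
      have hrad : 2 * loopLen shapes * (2 * k + 1) ≤ 4 * loopLen shapes * (k + 1) := by nlinarith
      have hdep : DependsOn (loopTermN hd B shapes coef ν₀ k e.1) (linkBall (4 * loopLen shapes * (k + 1)) e) := by
        rw [he']
        exact depOn_mono (linkBall_mono hrad _) (loopTermN_mem hd B shapes coef ν₀ k e.1).2
      simp only [he, if_true]
      exact hdep hWW'
    · simp only [he, if_false]
  · funext W
    simp only [loopSk, Fintype.sum_prod_type, Finset.sum_ite_eq', Finset.mem_univ, if_true]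

/-! ## §3. The recursion (4.12)–(4.15) -/

/-- Order zero: `Δ S̃^{(0)} = S + Ċ^{(0)}` on `SU(n)^E`. [cite: Luscher2010Trivializing, §4.3 eqs. (4.12), (4.14)] -/
theorem linkLap_loopSk_zero (U : GaugeConfig d L (Matrix.specialUnitaryGroup (Fin n) ℂ)) :
    linkLap B (loopSk hd B shapes coef ν₀ L 0) (WilsonFlow.coeConfig U) =
      loopAction shapes coef (WilsonFlow.coeConfig U) + loopConst hd B shapes coef ν₀ L 0 := by
  have h := linkLap_finset_sum B Finset.univ (fun x : Site d L => loopTermN hd B shapes coef ν₀ 0 x)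
    fun x _ => contDiff_loopTermN hd B shapes coef ν₀ 0 x
  have hterm : ∀ x : Site d L, linkLap B (loopTermN hd B shapes coef ν₀ 0 x) (WilsonFlow.coeConfig U) =
      loopSite shapes coef x (WilsonFlow.coeConfig U) - haarMean (loopSite (n := n) shapes coef x) := by
    intro x
    rw [linkLap_loopTermN, loopTerm_zero, linkLap_solvePD]
    rfl
  have hS : loopAction shapes coef (WilsonFlow.coeConfig U) =
      ∑ x : Site d L, loopSite shapes coef x (WilsonFlow.coeConfig U) := rfl
  calc linkLap B (loopSk hd B shapes coef ν₀ L 0) (WilsonFlow.coeConfig U)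
      = ∑ x : Site d L, linkLap B (loopTermN hd B shapes coef ν₀ 0 x) (WilsonFlow.coeConfig U) := by
        show linkLap B (fun W => ∑ x : Site d L, loopTermN hd B shapes coef ν₀ 0 x W) _ = _
        rw [h]
    _ = loopAction shapes coef (WilsonFlow.coeConfig U) + loopConst hd B shapes coef ν₀ L 0 := by
        rw [Finset.sum_congr rfl fun x _ => hterm x, Finset.sum_sub_distrib, hS]
        simp only [loopConst]
        ring

/-- The bilinear term is additive in the anchor: `∑_x ∑_{e',a} ∂S ∂G^{(k)}_x = ∑_{e',a} ∂S ∂S̃^{(k)}`.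
[folklore] -/
theorem sum_actionRhs_eq (k : ℕ) (W : AmbConfig d L n) :
    ∑ x : Site d L, actionRhs B (loopAction shapes coef) (loopTerm hd B shapes coef ν₀ k x) W =
      ∑ e' : Edge d L, ∑ a : B.ι,
        linkDeriv e' (B.T a) (loopAction shapes coef : AmbConfig d L n → ℝ) W *
          linkDeriv e' (B.T a) (loopSk hd B shapes coef ν₀ L k) W := by
  have hD : ∀ (e' : Edge d L) (a : B.ι), linkDeriv e' (B.T a) (loopSk hd B shapes coef ν₀ L k) W =
      ∑ x : Site d L, linkDeriv e' (B.T a) (loopTerm hd B shapes coef ν₀ k x) W := fun e' a => by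
    have h := congrFun (linkDeriv_finset_sum e' (B.T a) Finset.univ
      (fun x : Site d L => loopTermN hd B shapes coef ν₀ k x)
      fun x _ => contDiff_loopTermN hd B shapes coef ν₀ k x) W
    simp only [linkDeriv_loopTermN] at h
    exact h
  simp only [hD, actionRhs, Finset.mul_sum]
  rw [Finset.sum_comm]
  exact Finset.sum_congr rfl fun e' _ => Finset.sum_comm

/-- Order `k+1`: `Δ S̃^{(k+1)} = -∑_{e,a} ∂^a_e S · ∂^a_e S̃^{(k)} + Ċ^{(k+1)}` on `SU(n)^E`.
[cite: Luscher2010Trivializing, §4.3 eqs. (4.13), (4.15)] -/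
theorem linkLap_loopSk_succ (k : ℕ) (U : GaugeConfig d L (Matrix.specialUnitaryGroup (Fin n) ℂ)) :
    linkLap B (loopSk hd B shapes coef ν₀ L (k + 1)) (WilsonFlow.coeConfig U) =
      -(∑ e : Edge d L, ∑ a : B.ι,
          linkDeriv e (B.T a) (loopAction shapes coef : AmbConfig d L n → ℝ) (WilsonFlow.coeConfig U) *
            linkDeriv e (B.T a) (loopSk hd B shapes coef ν₀ L k) (WilsonFlow.coeConfig U)) +
        loopConst hd B shapes coef ν₀ L (k + 1) := by
  have h := linkLap_finset_sum B Finset.univ (fun x : Site d L => loopTermN hd B shapes coef ν₀ (k + 1) x)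
    fun x _ => contDiff_loopTermN hd B shapes coef ν₀ (k + 1) x
  have hterm : ∀ x : Site d L, linkLap B (loopTermN hd B shapes coef ν₀ (k + 1) x) (WilsonFlow.coeConfig U) =
      -actionRhs B (loopAction shapes coef) (loopTerm hd B shapes coef ν₀ k x) (WilsonFlow.coeConfig U) +
        haarMean (actionRhs B (loopAction shapes coef) (loopTerm hd B shapes coef ν₀ k x)) := by
    intro x
    rw [linkLap_loopTermN, loopTerm_succ, linkLap_solvePD]
    simp only [Pi.neg_apply, integral_neg, sub_neg_eq_add, haarMean]
  rw [← sum_actionRhs_eq]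
  calc linkLap B (loopSk hd B shapes coef ν₀ L (k + 1)) (WilsonFlow.coeConfig U)
      = ∑ x : Site d L, linkLap B (loopTermN hd B shapes coef ν₀ (k + 1) x) (WilsonFlow.coeConfig U) := by
        show linkLap B (fun W => ∑ x : Site d L, loopTermN hd B shapes coef ν₀ (k + 1) x W) _ = _
        rw [h]
    _ = -(∑ x : Site d L, actionRhs B (loopAction shapes coef) (loopTerm hd B shapes coef ν₀ k x)
            (WilsonFlow.coeConfig U)) + loopConst hd B shapes coef ν₀ L (k + 1) := by
        rw [Finset.sum_congr rfl fun x _ => hterm x, Finset.sum_add_distrib, Finset.sum_neg_distrib]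
        simp only [loopConst]

/-- **The anchored recursion solves Lüscher's recursion** (4.12)–(4.15) for the loop action, with the
constants `loopConst`. [cite: Luscher2010Trivializing, §4.3 eqs. (4.12)–(4.15)] -/
theorem isLuscherSeries_loopSk :
    IsLuscherSeries B (loopAction shapes coef) (loopSk hd B shapes coef ν₀ L) (loopConst hd B shapes coef ν₀ L) :=
  ⟨fun U => linkLap_loopSk_zero hd B shapes coef ν₀ L U, fun k U => linkLap_loopSk_succ hd B shapes coef ν₀ L k U⟩

end Terms

/-! ## §4. `LuscherSeriesLocal` in dimension `d ≥ 2` -/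

/-- **Lüscher §4.5(b) for loop actions, `d ≥ 2`**: for every finite family of loop shapes with complex
coefficients, with `C = 4ℓ` (`ℓ` the maximal loop length; independent of the lattice size and of the basis),
on every periodic lattice the recursion (4.12)–(4.15) for `S = ∑_x ∑_C Re(c_C tr U(C_x))` has a smooth,
Haar-normalised solution whose order-`k` term is a local sum of range `≤ C (k+1)`. (Closedness of the words
is not needed in `d ≥ 2`.) [cite: Luscher2010Trivializing, §4.5(b)] -/
theorem luscherSeriesLocal_of_two_le {d : ℕ} (hd : 2 ≤ d) (n : ℕ) : LuscherSeriesLocal d n := by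
  intro shapes coef _
  refine ⟨4 * loopLen shapes, ?_⟩
  intro L _ B
  exact ⟨loopSk hd B shapes coef ⟨0, by omega⟩ L, loopConst hd B shapes coef ⟨0, by omega⟩ L,
    isLuscherSeries_loopSk hd B shapes coef _ L, isHaarNormalised_loopSk hd B shapes coef _ L,
    fun k => contDiff_loopSk hd B shapes coef _ L k, fun k => isLocalSum_loopSk hd B shapes coef _ L k⟩

end

end Summit.Ventures.LatticeQCDFlow.TrivializingMaps
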